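import Summits.CriticalPhenomena.PercolationContinuityZ3.Theorems.Transplant.FKConnectivityAllQPat3BridgeB0Data
import HarnessLib

/-!
# Connectivity correlation inequalities for `φ_{w,q}`, every `q > 0` — THE BRIDGE LEAF B0 of census g39 §3 (the bridge graph itself:
# kernel facts `…Pat3BridgeB0Data` plugged into `FK.shape0_nonneg_of_check`)

Theorems file (`--supports stmt-CriticalPhenomena-4575`), census lineage (gen 40) of LANE 2's FK sub-programme; builds on p205010 (kernel
theorem, internal audit signed; external expert review pending).  No named facts, no sorries; standard axioms.

For injective `p : Fin 4 → V` (`a b c d = p 0 … p 3`), each of the ten distinct `famP11` tables `F` and `s ∈ {c, d}`: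
`FK.bridgeB0c_<F>_level_nonneg` / `FK.bridgeB0d_<F>_level_nonneg` : `0 ≤ lev2 (plainSet p skelB0) (p 0) (p 1) (p 2|3) F μ` for every
level `μ` — census g39's 𝒯₂-leaf B0 («T2goal at a bridge with the inner mark at a vertex: exact base»).  Side conditions `FK.skelB0_ne/_nodup`.
[cite: AyyerLinussonRavichandran2025, §7 (p. 22)]
-/

namespace Summit.CriticalPhenomena.PercolationContinuityZ3.Theorems

namespace FK

open SimpleGraph Literature.Probability.LatticeModels Literature.Probability.Percolation
open scoped Classical

variable {V : Type*}
/-! ### THE BRIDGE LEAF B0 (census g39 §3): the bridge graph itself, exact base via `FK.shape0_nonneg_of_check` -/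

section BridgeLeafB0

/-- Distinct names give distinct edges of the bridge graph (B0). [folklore] -/
theorem skelB0_ne {p : Fin 4 → V} (hinj : Function.Injective p) : ∀ e ∈ skelB0, p e.1 ≠ p e.2 := by
  intro e he
  simp only [skelB0, List.mem_cons, List.mem_nil_iff, or_false] at he
  rcases he with rfl | rfl | rfl | rfl | rfl <;> exact hinj.ne (by decide)


/-- The bridge graph's edges are distinct (B0). [folklore] -/
theorem skelB0_nodup {p : Fin 4 → V} (hinj : Function.Injective p) : (skelB0.map (pedge p)).Nodup := by
  simp only [skelB0, List.map_cons, List.map_nil, pedge, List.nodup_cons, List.mem_cons, List.not_mem_nil,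
    not_false_eq_true, List.nodup_nil, and_true, or_false, Sym2.eq, Sym2.rel_iff', Prod.mk.injEq, Prod.swap_prod_mk, hinj.eq_iff,
    not_or, not_and]
  decide


variable [Fintype V]

/-- **LEAF B0 (tsym2Tab at `(a, b, c)` on the bridge graph itself)** (kernel fact `FK.bridgeB0c_tsym`): for four injective
names `a b c d = p 0 … p 3`, `tsym2Tab` is levelwise nonnegative at `(p 0, p 1, p 2)` on `K₄ - ab` = `plainSet p skelB0`.
[cite: AyyerLinussonRavichandran2025, §7 (p. 22)] -/
theorem bridgeB0c_tsym_level_nonneg {p : Fin 4 → V} (hinj : Function.Injective p) (μ : ℕ) :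
    0 ≤ lev2 (plainSet p skelB0) (p 0) (p 1) (p 2) tsym2Tab μ :=
  shape0_nonneg_of_check hinj rfl rfl rfl (skelB0_ne hinj) (skelB0_nodup hinj) bridgeB0c_tsym μ


/-- **LEAF B0 (tsym2Tab at `(a, b, d)` on the bridge graph itself)** (kernel fact `FK.bridgeB0d_tsym`): for four injective
names `a b c d = p 0 … p 3`, `tsym2Tab` is levelwise nonnegative at `(p 0, p 1, p 3)` on `K₄ - ab` = `plainSet p skelB0`.
[cite: AyyerLinussonRavichandran2025, §7 (p. 22)] -/
theorem bridgeB0d_tsym_level_nonneg {p : Fin 4 → V} (hinj : Function.Injective p) (μ : ℕ) :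
    0 ≤ lev2 (plainSet p skelB0) (p 0) (p 1) (p 3) tsym2Tab μ :=
  shape0_nonneg_of_check hinj rfl rfl rfl (skelB0_ne hinj) (skelB0_nodup hinj) bridgeB0d_tsym μ


/-- **LEAF B0 (starXTab at `(a, b, c)` on the bridge graph itself)** (kernel fact `FK.bridgeB0c_starX`): for four injective
names `a b c d = p 0 … p 3`, `starXTab` is levelwise nonnegative at `(p 0, p 1, p 2)` on `K₄ - ab` = `plainSet p skelB0`.
[cite: AyyerLinussonRavichandran2025, §7 (p. 22)] -/
theorem bridgeB0c_starX_level_nonneg {p : Fin 4 → V} (hinj : Function.Injective p) (μ : ℕ) :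
    0 ≤ lev2 (plainSet p skelB0) (p 0) (p 1) (p 2) starXTab μ :=
  shape0_nonneg_of_check hinj rfl rfl rfl (skelB0_ne hinj) (skelB0_nodup hinj) bridgeB0c_starX μ


/-- **LEAF B0 (starXTab at `(a, b, d)` on the bridge graph itself)** (kernel fact `FK.bridgeB0d_starX`): for four injective
names `a b c d = p 0 … p 3`, `starXTab` is levelwise nonnegative at `(p 0, p 1, p 3)` on `K₄ - ab` = `plainSet p skelB0`.
[cite: AyyerLinussonRavichandran2025, §7 (p. 22)] -/
theorem bridgeB0d_starX_level_nonneg {p : Fin 4 → V} (hinj : Function.Injective p) (μ : ℕ) :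
    0 ≤ lev2 (plainSet p skelB0) (p 0) (p 1) (p 3) starXTab μ :=
  shape0_nonneg_of_check hinj rfl rfl rfl (skelB0_ne hinj) (skelB0_nodup hinj) bridgeB0d_starX μ


/-- **LEAF B0 ((mirror2 starXTab) at `(a, b, c)` on the bridge graph itself)** (kernel fact `FK.bridgeB0c_starXm`): for four injective
names `a b c d = p 0 … p 3`, `(mirror2 starXTab)` is levelwise nonnegative at `(p 0, p 1, p 2)` on `K₄ - ab` = `plainSet p skelB0`.
[cite: AyyerLinussonRavichandran2025, §7 (p. 22)] -/
theorem bridgeB0c_starXm_level_nonneg {p : Fin 4 → V} (hinj : Function.Injective p) (μ : ℕ) :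
    0 ≤ lev2 (plainSet p skelB0) (p 0) (p 1) (p 2) (mirror2 starXTab) μ :=
  shape0_nonneg_of_check hinj rfl rfl rfl (skelB0_ne hinj) (skelB0_nodup hinj) bridgeB0c_starXm μ


/-- **LEAF B0 ((mirror2 starXTab) at `(a, b, d)` on the bridge graph itself)** (kernel fact `FK.bridgeB0d_starXm`): for four injective
names `a b c d = p 0 … p 3`, `(mirror2 starXTab)` is levelwise nonnegative at `(p 0, p 1, p 3)` on `K₄ - ab` = `plainSet p skelB0`.
[cite: AyyerLinussonRavichandran2025, §7 (p. 22)] -/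
theorem bridgeB0d_starXm_level_nonneg {p : Fin 4 → V} (hinj : Function.Injective p) (μ : ℕ) :
    0 ≤ lev2 (plainSet p skelB0) (p 0) (p 1) (p 3) (mirror2 starXTab) μ :=
  shape0_nonneg_of_check hinj rfl rfl rfl (skelB0_ne hinj) (skelB0_nodup hinj) bridgeB0d_starXm μ


/-- **LEAF B0 (starSTab at `(a, b, c)` on the bridge graph itself)** (kernel fact `FK.bridgeB0c_starS`): for four injective
names `a b c d = p 0 … p 3`, `starSTab` is levelwise nonnegative at `(p 0, p 1, p 2)` on `K₄ - ab` = `plainSet p skelB0`.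
[cite: AyyerLinussonRavichandran2025, §7 (p. 22)] -/
theorem bridgeB0c_starS_level_nonneg {p : Fin 4 → V} (hinj : Function.Injective p) (μ : ℕ) :
    0 ≤ lev2 (plainSet p skelB0) (p 0) (p 1) (p 2) starSTab μ :=
  shape0_nonneg_of_check hinj rfl rfl rfl (skelB0_ne hinj) (skelB0_nodup hinj) bridgeB0c_starS μ


/-- **LEAF B0 (starSTab at `(a, b, d)` on the bridge graph itself)** (kernel fact `FK.bridgeB0d_starS`): for four injective
names `a b c d = p 0 … p 3`, `starSTab` is levelwise nonnegative at `(p 0, p 1, p 3)` on `K₄ - ab` = `plainSet p skelB0`.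
[cite: AyyerLinussonRavichandran2025, §7 (p. 22)] -/
theorem bridgeB0d_starS_level_nonneg {p : Fin 4 → V} (hinj : Function.Injective p) (μ : ℕ) :
    0 ≤ lev2 (plainSet p skelB0) (p 0) (p 1) (p 3) starSTab μ :=
  shape0_nonneg_of_check hinj rfl rfl rfl (skelB0_ne hinj) (skelB0_nodup hinj) bridgeB0d_starS μ


/-- **LEAF B0 (c1plusTab at `(a, b, c)` on the bridge graph itself)** (kernel fact `FK.bridgeB0c_c1plus`): for four injective
names `a b c d = p 0 … p 3`, `c1plusTab` is levelwise nonnegative at `(p 0, p 1, p 2)` on `K₄ - ab` = `plainSet p skelB0`.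
[cite: AyyerLinussonRavichandran2025, §7 (p. 22)] -/
theorem bridgeB0c_c1plus_level_nonneg {p : Fin 4 → V} (hinj : Function.Injective p) (μ : ℕ) :
    0 ≤ lev2 (plainSet p skelB0) (p 0) (p 1) (p 2) c1plusTab μ :=
  shape0_nonneg_of_check hinj rfl rfl rfl (skelB0_ne hinj) (skelB0_nodup hinj) bridgeB0c_c1plus μ


/-- **LEAF B0 (c1plusTab at `(a, b, d)` on the bridge graph itself)** (kernel fact `FK.bridgeB0d_c1plus`): for four injective
names `a b c d = p 0 … p 3`, `c1plusTab` is levelwise nonnegative at `(p 0, p 1, p 3)` on `K₄ - ab` = `plainSet p skelB0`.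
[cite: AyyerLinussonRavichandran2025, §7 (p. 22)] -/
theorem bridgeB0d_c1plus_level_nonneg {p : Fin 4 → V} (hinj : Function.Injective p) (μ : ℕ) :
    0 ≤ lev2 (plainSet p skelB0) (p 0) (p 1) (p 3) c1plusTab μ :=
  shape0_nonneg_of_check hinj rfl rfl rfl (skelB0_ne hinj) (skelB0_nodup hinj) bridgeB0d_c1plus μ


/-- **LEAF B0 (c2Tab at `(a, b, c)` on the bridge graph itself)** (kernel fact `FK.bridgeB0c_c2`): for four injective
names `a b c d = p 0 … p 3`, `c2Tab` is levelwise nonnegative at `(p 0, p 1, p 2)` on `K₄ - ab` = `plainSet p skelB0`.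
[cite: AyyerLinussonRavichandran2025, §7 (p. 22)] -/
theorem bridgeB0c_c2_level_nonneg {p : Fin 4 → V} (hinj : Function.Injective p) (μ : ℕ) :
    0 ≤ lev2 (plainSet p skelB0) (p 0) (p 1) (p 2) c2Tab μ :=
  shape0_nonneg_of_check hinj rfl rfl rfl (skelB0_ne hinj) (skelB0_nodup hinj) bridgeB0c_c2 μ


/-- **LEAF B0 (c2Tab at `(a, b, d)` on the bridge graph itself)** (kernel fact `FK.bridgeB0d_c2`): for four injective
names `a b c d = p 0 … p 3`, `c2Tab` is levelwise nonnegative at `(p 0, p 1, p 3)` on `K₄ - ab` = `plainSet p skelB0`.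
[cite: AyyerLinussonRavichandran2025, §7 (p. 22)] -/
theorem bridgeB0d_c2_level_nonneg {p : Fin 4 → V} (hinj : Function.Injective p) (μ : ℕ) :
    0 ≤ lev2 (plainSet p skelB0) (p 0) (p 1) (p 3) c2Tab μ :=
  shape0_nonneg_of_check hinj rfl rfl rfl (skelB0_ne hinj) (skelB0_nodup hinj) bridgeB0d_c2 μ


/-- **LEAF B0 (s1c1Tab at `(a, b, c)` on the bridge graph itself)** (kernel fact `FK.bridgeB0c_s1c1`): for four injective
names `a b c d = p 0 … p 3`, `s1c1Tab` is levelwise nonnegative at `(p 0, p 1, p 2)` on `K₄ - ab` = `plainSet p skelB0`.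
[cite: AyyerLinussonRavichandran2025, §7 (p. 22)] -/
theorem bridgeB0c_s1c1_level_nonneg {p : Fin 4 → V} (hinj : Function.Injective p) (μ : ℕ) :
    0 ≤ lev2 (plainSet p skelB0) (p 0) (p 1) (p 2) s1c1Tab μ :=
  shape0_nonneg_of_check hinj rfl rfl rfl (skelB0_ne hinj) (skelB0_nodup hinj) bridgeB0c_s1c1 μ


/-- **LEAF B0 (s1c1Tab at `(a, b, d)` on the bridge graph itself)** (kernel fact `FK.bridgeB0d_s1c1`): for four injective
names `a b c d = p 0 … p 3`, `s1c1Tab` is levelwise nonnegative at `(p 0, p 1, p 3)` on `K₄ - ab` = `plainSet p skelB0`.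
[cite: AyyerLinussonRavichandran2025, §7 (p. 22)] -/
theorem bridgeB0d_s1c1_level_nonneg {p : Fin 4 → V} (hinj : Function.Injective p) (μ : ℕ) :
    0 ≤ lev2 (plainSet p skelB0) (p 0) (p 1) (p 3) s1c1Tab μ :=
  shape0_nonneg_of_check hinj rfl rfl rfl (skelB0_ne hinj) (skelB0_nodup hinj) bridgeB0d_s1c1 μ


/-- **LEAF B0 ((mirror2 s1c1Tab) at `(a, b, c)` on the bridge graph itself)** (kernel fact `FK.bridgeB0c_s1c1m`): for four injective
names `a b c d = p 0 … p 3`, `(mirror2 s1c1Tab)` is levelwise nonnegative at `(p 0, p 1, p 2)` on `K₄ - ab` = `plainSet p skelB0`.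
[cite: AyyerLinussonRavichandran2025, §7 (p. 22)] -/
theorem bridgeB0c_s1c1m_level_nonneg {p : Fin 4 → V} (hinj : Function.Injective p) (μ : ℕ) :
    0 ≤ lev2 (plainSet p skelB0) (p 0) (p 1) (p 2) (mirror2 s1c1Tab) μ :=
  shape0_nonneg_of_check hinj rfl rfl rfl (skelB0_ne hinj) (skelB0_nodup hinj) bridgeB0c_s1c1m μ


/-- **LEAF B0 ((mirror2 s1c1Tab) at `(a, b, d)` on the bridge graph itself)** (kernel fact `FK.bridgeB0d_s1c1m`): for four injective
names `a b c d = p 0 … p 3`, `(mirror2 s1c1Tab)` is levelwise nonnegative at `(p 0, p 1, p 3)` on `K₄ - ab` = `plainSet p skelB0`.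
[cite: AyyerLinussonRavichandran2025, §7 (p. 22)] -/
theorem bridgeB0d_s1c1m_level_nonneg {p : Fin 4 → V} (hinj : Function.Injective p) (μ : ℕ) :
    0 ≤ lev2 (plainSet p skelB0) (p 0) (p 1) (p 3) (mirror2 s1c1Tab) μ :=
  shape0_nonneg_of_check hinj rfl rfl rfl (skelB0_ne hinj) (skelB0_nodup hinj) bridgeB0d_s1c1m μ


/-- **LEAF B0 (s1c3Tab at `(a, b, c)` on the bridge graph itself)** (kernel fact `FK.bridgeB0c_s1c3`): for four injective
names `a b c d = p 0 … p 3`, `s1c3Tab` is levelwise nonnegative at `(p 0, p 1, p 2)` on `K₄ - ab` = `plainSet p skelB0`.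
[cite: AyyerLinussonRavichandran2025, §7 (p. 22)] -/
theorem bridgeB0c_s1c3_level_nonneg {p : Fin 4 → V} (hinj : Function.Injective p) (μ : ℕ) :
    0 ≤ lev2 (plainSet p skelB0) (p 0) (p 1) (p 2) s1c3Tab μ :=
  shape0_nonneg_of_check hinj rfl rfl rfl (skelB0_ne hinj) (skelB0_nodup hinj) bridgeB0c_s1c3 μ


/-- **LEAF B0 (s1c3Tab at `(a, b, d)` on the bridge graph itself)** (kernel fact `FK.bridgeB0d_s1c3`): for four injective
names `a b c d = p 0 … p 3`, `s1c3Tab` is levelwise nonnegative at `(p 0, p 1, p 3)` on `K₄ - ab` = `plainSet p skelB0`.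
[cite: AyyerLinussonRavichandran2025, §7 (p. 22)] -/
theorem bridgeB0d_s1c3_level_nonneg {p : Fin 4 → V} (hinj : Function.Injective p) (μ : ℕ) :
    0 ≤ lev2 (plainSet p skelB0) (p 0) (p 1) (p 3) s1c3Tab μ :=
  shape0_nonneg_of_check hinj rfl rfl rfl (skelB0_ne hinj) (skelB0_nodup hinj) bridgeB0d_s1c3 μ


/-- **LEAF B0 ((mirror2 s1c3Tab) at `(a, b, c)` on the bridge graph itself)** (kernel fact `FK.bridgeB0c_s1c3m`): for four injective
names `a b c d = p 0 … p 3`, `(mirror2 s1c3Tab)` is levelwise nonnegative at `(p 0, p 1, p 2)` on `K₄ - ab` = `plainSet p skelB0`.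
[cite: AyyerLinussonRavichandran2025, §7 (p. 22)] -/
theorem bridgeB0c_s1c3m_level_nonneg {p : Fin 4 → V} (hinj : Function.Injective p) (μ : ℕ) :
    0 ≤ lev2 (plainSet p skelB0) (p 0) (p 1) (p 2) (mirror2 s1c3Tab) μ :=
  shape0_nonneg_of_check hinj rfl rfl rfl (skelB0_ne hinj) (skelB0_nodup hinj) bridgeB0c_s1c3m μ


/-- **LEAF B0 ((mirror2 s1c3Tab) at `(a, b, d)` on the bridge graph itself)** (kernel fact `FK.bridgeB0d_s1c3m`): for four injective
names `a b c d = p 0 … p 3`, `(mirror2 s1c3Tab)` is levelwise nonnegative at `(p 0, p 1, p 3)` on `K₄ - ab` = `plainSet p skelB0`.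
[cite: AyyerLinussonRavichandran2025, §7 (p. 22)] -/
theorem bridgeB0d_s1c3m_level_nonneg {p : Fin 4 → V} (hinj : Function.Injective p) (μ : ℕ) :
    0 ≤ lev2 (plainSet p skelB0) (p 0) (p 1) (p 3) (mirror2 s1c3Tab) μ :=
  shape0_nonneg_of_check hinj rfl rfl rfl (skelB0_ne hinj) (skelB0_nodup hinj) bridgeB0d_s1c3m μ


end BridgeLeafB0

end FK

end Summit.CriticalPhenomena.PercolationContinuityZ3.Theorems
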